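import Summits.CriticalPhenomena.CardyFormulaZ2.Theorems.CardySelfRefinementLagHandOffDiscreteLocalityArcs
import Summits.CriticalPhenomena.CardyFormulaZ2.Theorems.CardySelfRefinementLagHandOffDiscreteSplittingGeometry
import HarnessLib

/-!
# Metric geometry of nested Dobrushin domains: helper for stub `stub_discreteLocality` (R3a) of
line `hitting-tournament` for crux `LagHandOff` (stmt-CriticalPhenomena-10268)

Pure metric bookkeeping for the patching of labellings (`…DiscreteLocalityPatch.lean`):

* the two arcs of a Dobrushin domain meet only at the marked points, hence AWAY from the marked
  points no point is close to both arcs (`exists_arcs_separated`, compactness);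
* for nested domains `D'' ⊆ D` with compatible arcs (output of `exists_arcCompatible'`), a point
  close to an arc of `D` and off the removed part `F = closure (D ∖ D'')` is as close to the
  corresponding arc of `D''` (`infDist_arc_le_of_compatible`);
* off `F` the two frontiers agree, so the distances to them agree (`infDist_frontier_eq_of_far`).
-/

noncomputable section

open Set Filter Topology Metric
open Literature.Probability.RandomPlanarGeometry

namespace Summit.CriticalPhenomena.CardyFormulaZ2.Cruxes.LagHandOff.HittingTournament

/-! ### The two arcs meet only at the marked points -/

/-- The two arcs of a Dobrushin domain meet only at the two marked points. -/
theorem arc_zero_inter_arc_one_subset (D : DobrushinDomain) : D.arc 0 ∩ D.arc 1 ⊆ {D.pt 0, D.pt 1} := by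
  rintro z ⟨h0, h1⟩
  by_contra hz
  simp only [mem_insert_iff, mem_singleton_iff, not_or] at hz
  exact (mem_arc_one_iff_not_mem_arc_zero D (D.arc_subset_frontier 0 h0) hz.1 hz.2).1 h1 h0

/-- **Away from the marked points, no point is close to both arcs.** For `r > 0` there is `μ > 0`
such that no point at distance `≥ r` from both marked points is within `μ` of both arcs. -/
theorem exists_arcs_separated (D : DobrushinDomain) {r : ℝ} (hr : 0 < r) :
    ∃ μ : ℝ, 0 < μ ∧ ∀ z : ℂ, r ≤ dist z (D.pt 0) → r ≤ dist z (D.pt 1) →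
      infDist z (D.arc 0) ≤ μ → infDist z (D.arc 1) ≤ μ → False := by
  set g : ℂ → ℝ := fun z => infDist z (D.arc 0) + infDist z (D.arc 1) with hg
  have hgc : Continuous g := (continuous_infDist_pt _).add (continuous_infDist_pt _)
  have hne : ∀ i, (D.arc i).Nonempty := fun i => ⟨_, D.pt_mem_arc_self i⟩
  set K := cthickening 1 (D.arc 0) ∩ {z | r ≤ dist z (D.pt 0)} ∩ {z | r ≤ dist z (D.pt 1)} with hK
  have hKc : IsCompact K :=
    ((D.isCompact_arc 0).cthickening.inter_right
      (isClosed_le continuous_const (continuous_id.dist continuous_const))).inter_right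
      (isClosed_le continuous_const (continuous_id.dist continuous_const))
  have hmemK : ∀ {z : ℂ}, r ≤ dist z (D.pt 0) → r ≤ dist z (D.pt 1) → infDist z (D.arc 0) ≤ 1 → z ∈ K :=
    fun h0 h1 h => ⟨⟨by
      obtain ⟨y, hy, hyd⟩ := (D.isCompact_arc 0).exists_infDist_eq_dist (hne 0) _
      exact mem_cthickening_of_dist_le _ y 1 _ hy (hyd ▸ h), h0⟩, h1⟩
  rcases K.eq_empty_or_nonempty with hKe | hKne
  · refine ⟨1 / 2, by norm_num, fun z h0 h1 ha _ => ?_⟩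
    have : z ∈ K := hmemK h0 h1 (ha.trans (by norm_num))
    rw [hKe] at this
    exact this
  obtain ⟨z₀, hz₀, hmin⟩ := hKc.exists_isMinOn hKne hgc.continuousOn
  have hpos : 0 < g z₀ := by
    by_contra hle
    push Not at hle
    have h0 : infDist z₀ (D.arc 0) ≤ 0 := by
      simp only [hg] at hle; linarith [(infDist_nonneg : 0 ≤ infDist z₀ (D.arc 1))]
    have h1 : infDist z₀ (D.arc 1) ≤ 0 := by
      simp only [hg] at hle; linarith [(infDist_nonneg : 0 ≤ infDist z₀ (D.arc 0))]
    have hm0 := mem_of_infDist_le_zero (D.isCompact_arc 0) (hne 0) h0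
    have hm1 := mem_of_infDist_le_zero (D.isCompact_arc 1) (hne 1) h1
    rcases arc_zero_inter_arc_one_subset D ⟨hm0, hm1⟩ with h | h
    · have := hz₀.1.2
      rw [mem_setOf_eq, h, dist_self] at this
      linarith
    · have := hz₀.2
      rw [mem_setOf_eq, h, dist_self] at this
      linarith
  refine ⟨min (1 / 2) (g z₀ / 3), lt_min (by norm_num) (by linarith), fun z h0 h1 ha hb => ?_⟩
  have hzK : z ∈ K := hmemK h0 h1 (ha.trans ((min_le_left _ _).trans (by norm_num)))
  have hgz : g z₀ ≤ g z := hmin hzK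
  have : g z ≤ 2 * min (1 / 2) (g z₀ / 3) := by simp only [hg]; linarith
  linarith [min_le_right (1 / 2 : ℝ) (g z₀ / 3)]

/-- The marked points are at positive distance: half of it is a positive radius. -/
theorem dist_pt_pos (D : DobrushinDomain) : 0 < dist (D.pt 0) (D.pt 1) :=
  dist_pos.2 (D.pt_injective.ne (by decide))

/-! ### Closeness to compatible arcs -/

/-- **Closeness transfers to compatible arcs.** If every point of the arc `D.arc i` off `F` lies on
the set `A''` (e.g. the corresponding arc of a compatible inner domain), then a point within `ε` of
`D.arc i` all of whose `F`-points are farther than `ε` is within `ε` of `A''`. -/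
theorem infDist_arc_le_of_compatible (D : DobrushinDomain) (i : Fin 2) {F A'' : Set ℂ}
    (hA : ∀ z ∈ D.arc i, z ∉ F → z ∈ A'') {y : ℂ} {ε : ℝ} (hy : infDist y (D.arc i) ≤ ε)
    (hF : ∀ z ∈ F, ε < dist y z) : infDist y A'' ≤ ε := by
  obtain ⟨w, hw, hwd⟩ := (D.isCompact_arc i).exists_infDist_eq_dist ⟨_, D.pt_mem_arc_self i⟩ y
  have hwF : w ∉ F := fun h => by
    have := hF w h
    rw [← hwd] at this
    linarith
  exact (infDist_le_dist_of_mem (hA w hw hwF)).trans (hwd ▸ hy)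

/-! ### The two frontiers off the removed part -/

/-- A boundary point of the small (open) domain off the removed part is a boundary point of the
big (open) domain. -/
theorem mem_frontier_of_mem_frontier_inner {Ω Ω' : Set ℂ} (hΩ : IsOpen Ω) (hΩ' : IsOpen Ω')
    (hsub : Ω' ⊆ Ω) {z : ℂ} (hz : z ∈ frontier Ω') (hzF : z ∉ closure (Ω \ Ω')) : z ∈ frontier Ω := by
  refine ⟨closure_mono hsub hz.1, ?_⟩
  rw [hΩ.interior_eq]
  intro hzΩ
  have hzΩ' : z ∉ Ω' := by
    have := hz.2
    rwa [hΩ'.interior_eq] at this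
  exact hzF (subset_closure ⟨hzΩ, hzΩ'⟩)

/-- **Off the removed part, the distances to the two frontiers agree.** For open `Ω' ⊆ Ω` with
nonempty compact frontiers and a point `p` all of whose `F`-points are farther than its distance
to `∂Ω'`, `infDist p ∂Ω' = infDist p ∂Ω`. -/
theorem infDist_frontier_eq_of_far {Ω Ω' : Set ℂ} (hΩ : IsOpen Ω) (hΩ' : IsOpen Ω') (hsub : Ω' ⊆ Ω)
    (hc : IsCompact (frontier Ω)) (hne : (frontier Ω).Nonempty)
    (hc' : IsCompact (frontier Ω')) (hne' : (frontier Ω').Nonempty) {p : ℂ}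
    (hF : ∀ z ∈ closure (Ω \ Ω'), infDist p (frontier Ω') < dist p z) :
    infDist p (frontier Ω') = infDist p (frontier Ω) := by
  -- the nearest point of `∂Ω'` is off `F`, hence on `∂Ω`
  obtain ⟨w', hw', hw'd⟩ := hc'.exists_infDist_eq_dist hne' p
  have hw'F : w' ∉ closure (Ω \ Ω') := fun h => by
    have := hF w' h
    rw [hw'd] at this
    exact lt_irrefl _ this
  have hle : infDist p (frontier Ω) ≤ infDist p (frontier Ω') := by
    rw [hw'd]
    exact infDist_le_dist_of_mem (mem_frontier_of_mem_frontier_inner hΩ hΩ' hsub hw' hw'F)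
  refine le_antisymm ?_ hle
  -- the nearest point of `∂Ω` is off `F`, hence on `∂Ω'`
  obtain ⟨w, hw, hwd⟩ := hc.exists_infDist_eq_dist hne p
  have hwF : w ∉ closure (Ω \ Ω') := fun h => by
    have := hF w h
    rw [← hwd] at this
    linarith
  rw [hwd]
  exact infDist_le_dist_of_mem (mem_frontier_inner_of_not_mem_closure_diff hsub hw hwF)

/-- The frontier of a Jordan domain is compact. -/
theorem isCompact_frontier_carrier (D : JordanDomain) : IsCompact (frontier D.carrier) :=
  D.isBounded.isCompact_closure.of_isClosed_subset isClosed_frontier frontier_subset_closure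

/-- **Distances to the frontiers of nested Jordan domains agree off the removed part.** -/
theorem infDist_frontier_eq_of_far' (D D'' : JordanDomain) (hsub : D''.carrier ⊆ D.carrier) {p : ℂ}
    (hF : ∀ z ∈ closure (D.carrier \ D''.carrier), infDist p (frontier D''.carrier) < dist p z) :
    infDist p (frontier D''.carrier) = infDist p (frontier D.carrier) :=
  infDist_frontier_eq_of_far D.isOpen D''.isOpen hsub (isCompact_frontier_carrier D) D.frontier_nonempty
    (isCompact_frontier_carrier D'') D''.frontier_nonempty hF

/-! ### Registered sub-goal (one-line signature, verbatim) -/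

/-- **Registered sub-goal `stub_discreteLocality_geometry` of `stub_discreteLocality`**: away from
the marked points no point is close to both arcs, `exists_arcs_separated`, fully quantified. -/
theorem stub_discreteLocality_geometry : ∀ (D : DobrushinDomain) (r : ℝ), 0 < r → ∃ μ : ℝ, 0 < μ ∧ ∀ z : ℂ, r ≤ dist z (D.pt 0) → r ≤ dist z (D.pt 1) → Metric.infDist z (D.arc 0) ≤ μ → Metric.infDist z (D.arc 1) ≤ μ → False :=
  fun D _ hr => exists_arcs_separated D hr

end Summit.CriticalPhenomena.CardyFormulaZ2.Cruxes.LagHandOff.HittingTournament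

end
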